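import Mathlib
import Summits.NavierStokesRegularity.NavierStokesRegularity.Theorems.FilamentSkeletonRssMatchedKernelDirectionalDeriv

/-!
# Crux `SkeletonJ1R` (stmt-NavierStokesRegularity-23610) · line `streamline_kantorovich_R` · toward stub F2-d (`LiaDefectDerivBL`, v7):
# POINTWISE TOOLS FOR THE DERIVATIVE KERNEL `G(w,a,v) = (−3⟪w,v⟫K₅(w))•a×w + K₃(w)•a×v`

Lead `ns-fsr-lead-23610` g2, `--supports stmt-NavierStokesRegularity-23610 --as helper`.  MODEL rung, NEGATIVE side of the ladder: estimates for a
HYPOTHETICAL filament-type blow-up skeleton; nothing here is a claim about Navier–Stokes regularity; the stub and the crux stay OPEN.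

The integrands of `Ȧ_k`, `Ḃ_k` (`…LiaDefectDerivStrands`) are `G(y − X σ, X′σ, P)` with `K₃ = σ^{-3/2}`, `K₅ = σ^{-5/2}`, `σ = ‖w‖² + q`.  For the zone
bookkeeping of B1′/B2′ (`…LiaDefectDerivSplitBounds`):
* `norm_derivKernel_le` — the SHARP size `‖G(w,a,v)‖ ≤ 4‖a‖‖v‖·(σ^{3/2})⁻¹` (the toolkit's `norm_deriv_integrand_le` keeps only `σ⁻¹/√q`);
* `derivKernel_sub_left`, `norm_derivKernel_sub_left_le` — `G` is linear in `a`: `‖G(w,a₁,v) − G(w,a₂,v)‖ ≤ 4‖a₁ − a₂‖‖v‖·(σ^{3/2})⁻¹`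
  (the datum-tilt channel `a₁ = X′σ`, `a₂ = t_k`);
* `abs_rpow_neg_sub_le` — `|σ₁^{−p} − σ₂^{−p}| ≤ p·m^{−p−1}·|σ₁ − σ₂|` for `σ₁, σ₂ ≥ m > 0` (mean value), and
  `abs_norm_sq_sub_le` — `|‖w₁‖² − ‖w₂‖²| ≤ ‖w₁ − w₂‖(‖w₁‖ + ‖w₂‖)`: the displacement channel `w₁ = y − X σ`, `w₂ = y − L σ`.
-/

set_option linter.dupNamespace false -- `NavierStokesRegularity.NavierStokesRegularity` path/namespace repetition is the tree convention

noncomputable section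

namespace Summit.NavierStokesRegularity.NavierStokesRegularity.Theorems.SkeletonJ1RFrame

open Set Function Filter Real Topology MeasureTheory
open Literature.Analysis.FluidPDE
open Summit.NavierStokesRegularity.NavierStokesRegularity.Theorems.MatchedKernel
open scoped InnerProductSpace BigOperators

/-! ## §1 Size and linearity in the direction argument -/

/-- **Sharp size of the derivative kernel**: `‖(−3⟪w,v⟫(σ^{5/2})⁻¹)•a×w + (σ^{3/2})⁻¹•a×v‖ ≤ 4‖a‖‖v‖(σ^{3/2})⁻¹`, `σ = ‖w‖² + q > 0`. [folklore] -/
theorem norm_derivKernel_le {q : ℝ} (hq : 0 < q) (a w v : EuclideanSpace ℝ (Fin 3)) :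
    ‖(-3 * ⟪w, v⟫_ℝ * ((‖w‖ ^ 2 + q) ^ (5 / 2 : ℝ))⁻¹) • cross a w + ((‖w‖ ^ 2 + q) ^ (3 / 2 : ℝ))⁻¹ • cross a v‖ ≤
      4 * ‖a‖ * ‖v‖ * ((‖w‖ ^ 2 + q) ^ (3 / 2 : ℝ))⁻¹ := by
  set σ := ‖w‖ ^ 2 + q with hσ_def
  have hσ0 : 0 < σ := by positivity
  have hwσ : ‖w‖ ^ 2 ≤ σ := le_add_of_nonneg_right hq.le
  have hk3 : (σ ^ (3 / 2 : ℝ))⁻¹ = σ ^ (-(3 / 2) : ℝ) := (Real.rpow_neg hσ0.le _).symm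
  have hk5 : (σ ^ (5 / 2 : ℝ))⁻¹ = σ ^ (-(5 / 2) : ℝ) := (Real.rpow_neg hσ0.le _).symm
  have hcw : ‖cross a w‖ ≤ ‖a‖ * ‖w‖ := norm_cross_le_norm_mul_norm a w
  have hcv : ‖cross a v‖ ≤ ‖a‖ * ‖v‖ := norm_cross_le_norm_mul_norm a v
  have hi : |⟪w, v⟫_ℝ| ≤ ‖w‖ * ‖v‖ := abs_real_inner_le_norm w v
  have h1 : ‖(-3 * ⟪w, v⟫_ℝ * (σ ^ (5 / 2 : ℝ))⁻¹) • cross a w‖ ≤ 3 * ‖a‖ * ‖v‖ * σ ^ (-(3 / 2) : ℝ) := by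
    rw [norm_smul, hk5, Real.norm_eq_abs, abs_mul, abs_mul, abs_neg, abs_of_pos (by norm_num : (0 : ℝ) < 3),
      abs_of_nonneg (Real.rpow_nonneg hσ0.le _)]
    calc 3 * |⟪w, v⟫_ℝ| * σ ^ (-(5 / 2) : ℝ) * ‖cross a w‖
        ≤ 3 * (‖w‖ * ‖v‖) * σ ^ (-(5 / 2) : ℝ) * (‖a‖ * ‖w‖) := mul_le_mul (by gcongr) hcw (norm_nonneg _) (by positivity)
      _ = 3 * ‖a‖ * ‖v‖ * (σ ^ (-(5 / 2) : ℝ) * ‖w‖ ^ 2) := by ring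
      _ ≤ 3 * ‖a‖ * ‖v‖ * (σ ^ (-(5 / 2) : ℝ) * σ) := by gcongr
      _ = 3 * ‖a‖ * ‖v‖ * σ ^ (-(3 / 2) : ℝ) := by
          rw [show (-(3 / 2) : ℝ) = -(5 / 2) + 1 by norm_num, Real.rpow_add_one hσ0.ne']
  have h2 : ‖(σ ^ (3 / 2 : ℝ))⁻¹ • cross a v‖ ≤ ‖a‖ * ‖v‖ * σ ^ (-(3 / 2) : ℝ) := by
    rw [norm_smul, hk3, Real.norm_of_nonneg (Real.rpow_nonneg hσ0.le _), mul_comm]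
    exact mul_le_mul_of_nonneg_right hcv (Real.rpow_nonneg hσ0.le _)
  calc _ ≤ _ := norm_add_le _ _
    _ ≤ 3 * ‖a‖ * ‖v‖ * σ ^ (-(3 / 2) : ℝ) + ‖a‖ * ‖v‖ * σ ^ (-(3 / 2) : ℝ) := add_le_add h1 h2
    _ = 4 * ‖a‖ * ‖v‖ * (σ ^ (3 / 2 : ℝ))⁻¹ := by rw [hk3]; ring

/-- The derivative kernel is linear in the direction argument `a`. [folklore] -/
theorem derivKernel_sub_left (c₅ c₃ : ℝ) (a₁ a₂ w v : EuclideanSpace ℝ (Fin 3)) :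
    (c₅ • cross a₁ w + c₃ • cross a₁ v) - (c₅ • cross a₂ w + c₃ • cross a₂ v) = c₅ • cross (a₁ - a₂) w + c₃ • cross (a₁ - a₂) v := by
  have h1 : cross (a₁ - a₂) w = cross a₁ w - cross a₂ w := by
    rw [← crossCLM_apply, ← crossCLM_apply, ← crossCLM_apply, map_sub]; rfl
  have h2 : cross (a₁ - a₂) v = cross a₁ v - cross a₂ v := by
    rw [← crossCLM_apply, ← crossCLM_apply, ← crossCLM_apply, map_sub]; rfl
  rw [h1, h2, smul_sub, smul_sub]; abel

/-- **The datum-tilt channel**: `‖G(w,a₁,v) − G(w,a₂,v)‖ ≤ 4‖a₁ − a₂‖‖v‖(σ^{3/2})⁻¹`. [folklore] -/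
theorem norm_derivKernel_sub_left_le {q : ℝ} (hq : 0 < q) (a₁ a₂ w v : EuclideanSpace ℝ (Fin 3)) :
    ‖((-3 * ⟪w, v⟫_ℝ * ((‖w‖ ^ 2 + q) ^ (5 / 2 : ℝ))⁻¹) • cross a₁ w + ((‖w‖ ^ 2 + q) ^ (3 / 2 : ℝ))⁻¹ • cross a₁ v) -
      ((-3 * ⟪w, v⟫_ℝ * ((‖w‖ ^ 2 + q) ^ (5 / 2 : ℝ))⁻¹) • cross a₂ w + ((‖w‖ ^ 2 + q) ^ (3 / 2 : ℝ))⁻¹ • cross a₂ v)‖ ≤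
      4 * ‖a₁ - a₂‖ * ‖v‖ * ((‖w‖ ^ 2 + q) ^ (3 / 2 : ℝ))⁻¹ := by
  rw [derivKernel_sub_left]
  exact norm_derivKernel_le hq (a₁ - a₂) w v

/-! ## §2 The displacement channel: Lipschitz bounds for the powers and for `‖·‖²` -/

/-- **Mean-value bound for negative powers**: for `0 < p`, `0 < m ≤ σ₁, σ₂`: `|σ₁^{−p} − σ₂^{−p}| ≤ p·m^{−p−1}·|σ₁ − σ₂|`. [folklore] -/
theorem abs_rpow_neg_sub_le {p m σ₁ σ₂ : ℝ} (hp : 0 < p) (hm : 0 < m) (h1 : m ≤ σ₁) (h2 : m ≤ σ₂) :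
    |σ₁ ^ (-p) - σ₂ ^ (-p)| ≤ p * m ^ (-p - 1) * |σ₁ - σ₂| := by
  have hderiv : ∀ x ∈ Ici m, HasDerivWithinAt (fun x : ℝ => x ^ (-p)) (-p * x ^ (-p - 1)) (Ici m) x := fun x hx =>
    (Real.hasDerivAt_rpow_const (Or.inl (hm.trans_le hx).ne')).hasDerivWithinAt
  have hbound : ∀ x ∈ Ici m, ‖-p * x ^ (-p - 1)‖ ≤ p * m ^ (-p - 1) := by
    intro x hx
    have hx0 : 0 < x := hm.trans_le hx
    rw [Real.norm_eq_abs, abs_mul, abs_neg, abs_of_pos hp, abs_of_nonneg (Real.rpow_nonneg hx0.le _)]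
    refine mul_le_mul_of_nonneg_left ?_ hp.le
    exact Real.rpow_le_rpow_of_nonpos hm hx (by linarith)
  have h := Convex.norm_image_sub_le_of_norm_hasDerivWithin_le hderiv hbound (convex_Ici m) (mem_Ici.2 h2) (mem_Ici.2 h1)
  rw [Real.norm_eq_abs, Real.norm_eq_abs] at h
  exact h

/-- `|‖w₁‖² − ‖w₂‖²| ≤ ‖w₁ − w₂‖ · (‖w₁‖ + ‖w₂‖)`. [folklore] -/
theorem abs_norm_sq_sub_le (w₁ w₂ : EuclideanSpace ℝ (Fin 3)) : |‖w₁‖ ^ 2 - ‖w₂‖ ^ 2| ≤ ‖w₁ - w₂‖ * (‖w₁‖ + ‖w₂‖) := by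
  have h : ‖w₁‖ ^ 2 - ‖w₂‖ ^ 2 = ⟪w₁ - w₂, w₁ + w₂⟫_ℝ := by
    rw [inner_sub_left, inner_add_right, inner_add_right, real_inner_self_eq_norm_sq, real_inner_self_eq_norm_sq, real_inner_comm w₁ w₂]
    ring
  rw [h]
  exact (abs_real_inner_le_norm _ _).trans (mul_le_mul_of_nonneg_left (norm_add_le _ _) (norm_nonneg _))

/-- **The displacement channel for the kernels**: with `σ_i = ‖w_i‖² + q ≥ q > 0` and `‖w_i‖ ≤ Mw`,
`|(σ₁^{p})⁻¹ − (σ₂^{p})⁻¹| ≤ p·q^{−p−1}·2Mw·‖w₁ − w₂‖` for `p > 0` (coarse floor `m = q`; refine with a better floor where the distance is large). [folklore] -/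
theorem abs_inv_rpow_normSq_sub_le {q p Mw : ℝ} (hq : 0 < q) (hp : 0 < p) {w₁ w₂ : EuclideanSpace ℝ (Fin 3)} (hw₁ : ‖w₁‖ ≤ Mw)
    (hw₂ : ‖w₂‖ ≤ Mw) {m : ℝ} (hm : 0 < m) (hm₁ : m ≤ ‖w₁‖ ^ 2 + q) (hm₂ : m ≤ ‖w₂‖ ^ 2 + q) :
    |((‖w₁‖ ^ 2 + q) ^ p)⁻¹ - ((‖w₂‖ ^ 2 + q) ^ p)⁻¹| ≤ p * m ^ (-p - 1) * (2 * Mw) * ‖w₁ - w₂‖ := by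
  have hσ₁ : 0 < ‖w₁‖ ^ 2 + q := by positivity
  have hσ₂ : 0 < ‖w₂‖ ^ 2 + q := by positivity
  rw [← Real.rpow_neg hσ₁.le, ← Real.rpow_neg hσ₂.le]
  have h := abs_rpow_neg_sub_le hp hm hm₁ hm₂
  have hdiff : |(‖w₁‖ ^ 2 + q) - (‖w₂‖ ^ 2 + q)| ≤ ‖w₁ - w₂‖ * (2 * Mw) := by
    rw [show (‖w₁‖ ^ 2 + q) - (‖w₂‖ ^ 2 + q) = ‖w₁‖ ^ 2 - ‖w₂‖ ^ 2 by ring]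
    exact (abs_norm_sq_sub_le w₁ w₂).trans (mul_le_mul_of_nonneg_left (by linarith) (norm_nonneg _))
  calc _ ≤ p * m ^ (-p - 1) * |(‖w₁‖ ^ 2 + q) - (‖w₂‖ ^ 2 + q)| := h
    _ ≤ p * m ^ (-p - 1) * (‖w₁ - w₂‖ * (2 * Mw)) := mul_le_mul_of_nonneg_left hdiff (by positivity)
    _ = p * m ^ (-p - 1) * (2 * Mw) * ‖w₁ - w₂‖ := by ring

/-! ## §3 (append) The displacement channel for the whole derivative kernel:
`‖G(w₁,a,v) − G(w₂,a,v)‖ ≤ ‖a‖‖v‖‖w₁−w₂‖(9Mw·m^{−5/2} + 15Mw³·m^{−7/2})` for `‖w_i‖ ≤ Mw`, `m ≤ ‖w_i‖² + q` -/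

/-- A kernel with floor: `((‖w‖² + q)^{p})⁻¹ ≤ m^{−p}` when `m ≤ ‖w‖² + q`, `m > 0`, `p ≥ 0`. [folklore] -/
theorem inv_rpow_normSq_le {q p m : ℝ} (hp : 0 ≤ p) (hm : 0 < m) {w : EuclideanSpace ℝ (Fin 3)} (hmw : m ≤ ‖w‖ ^ 2 + q) :
    ((‖w‖ ^ 2 + q) ^ p)⁻¹ ≤ m ^ (-p) := by
  rw [Real.rpow_neg hm.le]
  exact inv_anti₀ (Real.rpow_pos_of_pos hm _) (Real.rpow_le_rpow hm.le hmw hp)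

/-- **The displacement channel**: for `‖w_i‖ ≤ Mw`, `0 < m ≤ ‖w_i‖² + q` (`q > 0`),
`‖G(w₁,a,v) − G(w₂,a,v)‖ ≤ ‖a‖‖v‖‖w₁ − w₂‖ · (9·Mw·m^{−5/2} + 15·Mw³·m^{−7/2})`. [folklore] -/
theorem norm_derivKernel_sub_right_le {q Mw m : ℝ} (hq : 0 < q) (hm : 0 < m) (a v : EuclideanSpace ℝ (Fin 3))
    {w₁ w₂ : EuclideanSpace ℝ (Fin 3)} (hw₁ : ‖w₁‖ ≤ Mw) (hw₂ : ‖w₂‖ ≤ Mw) (hm₁ : m ≤ ‖w₁‖ ^ 2 + q) (hm₂ : m ≤ ‖w₂‖ ^ 2 + q) :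
    ‖((-3 * ⟪w₁, v⟫_ℝ * ((‖w₁‖ ^ 2 + q) ^ (5 / 2 : ℝ))⁻¹) • cross a w₁ + ((‖w₁‖ ^ 2 + q) ^ (3 / 2 : ℝ))⁻¹ • cross a v) -
      ((-3 * ⟪w₂, v⟫_ℝ * ((‖w₂‖ ^ 2 + q) ^ (5 / 2 : ℝ))⁻¹) • cross a w₂ + ((‖w₂‖ ^ 2 + q) ^ (3 / 2 : ℝ))⁻¹ • cross a v)‖ ≤
      ‖a‖ * ‖v‖ * ‖w₁ - w₂‖ * (9 * Mw * m ^ (-(5 / 2 : ℝ)) + 15 * Mw ^ 3 * m ^ (-(7 / 2 : ℝ))) := by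
  set k₅₁ := ((‖w₁‖ ^ 2 + q) ^ (5 / 2 : ℝ))⁻¹ with hk₅₁
  set k₅₂ := ((‖w₂‖ ^ 2 + q) ^ (5 / 2 : ℝ))⁻¹ with hk₅₂
  set k₃₁ := ((‖w₁‖ ^ 2 + q) ^ (3 / 2 : ℝ))⁻¹ with hk₃₁
  set k₃₂ := ((‖w₂‖ ^ 2 + q) ^ (3 / 2 : ℝ))⁻¹ with hk₃₂
  have hMw : 0 ≤ Mw := (norm_nonneg _).trans hw₁
  -- sizes of the kernels and their differences
  have hk₅₁le : k₅₁ ≤ m ^ (-(5 / 2 : ℝ)) := inv_rpow_normSq_le (by norm_num) hm hm₁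
  have hk₅₂le : k₅₂ ≤ m ^ (-(5 / 2 : ℝ)) := inv_rpow_normSq_le (by norm_num) hm hm₂
  have hk₅₁0 : 0 ≤ k₅₁ := by positivity
  have hk₅₂0 : 0 ≤ k₅₂ := by positivity
  have hd5 : |k₅₁ - k₅₂| ≤ (5 / 2 : ℝ) * m ^ (-(7 / 2 : ℝ)) * (2 * Mw) * ‖w₁ - w₂‖ := by
    have h := abs_inv_rpow_normSq_sub_le (p := (5 / 2 : ℝ)) hq (by norm_num) hw₁ hw₂ hm hm₁ hm₂
    rwa [show (-(5 / 2 : ℝ) - 1) = -(7 / 2 : ℝ) by norm_num] at h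
  have hd3 : |k₃₁ - k₃₂| ≤ (3 / 2 : ℝ) * m ^ (-(5 / 2 : ℝ)) * (2 * Mw) * ‖w₁ - w₂‖ := by
    have h := abs_inv_rpow_normSq_sub_le (p := (3 / 2 : ℝ)) hq (by norm_num) hw₁ hw₂ hm hm₁ hm₂
    rwa [show (-(3 / 2 : ℝ) - 1) = -(5 / 2 : ℝ) by norm_num] at h
  -- telescoping
  have hcross : cross a (w₁ - w₂) = cross a w₁ - cross a w₂ := by
    rw [← crossCLM_apply, ← crossCLM_apply, ← crossCLM_apply, map_sub]
  have hsplit : ((-3 * ⟪w₁, v⟫_ℝ * k₅₁) • cross a w₁ + k₃₁ • cross a v) - ((-3 * ⟪w₂, v⟫_ℝ * k₅₂) • cross a w₂ + k₃₂ • cross a v) =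
      (-3 * ⟪w₁ - w₂, v⟫_ℝ * k₅₁) • cross a w₁ + (-3 * ⟪w₂, v⟫_ℝ * (k₅₁ - k₅₂)) • cross a w₁ +
        (-3 * ⟪w₂, v⟫_ℝ * k₅₂) • cross a (w₁ - w₂) + (k₃₁ - k₃₂) • cross a v := by
    rw [hcross, inner_sub_left]
    module
  rw [hsplit]
  -- the four terms
  have hi1 : |⟪w₁ - w₂, v⟫_ℝ| ≤ ‖w₁ - w₂‖ * ‖v‖ := abs_real_inner_le_norm _ _
  have hi2 : |⟪w₂, v⟫_ℝ| ≤ Mw * ‖v‖ := (abs_real_inner_le_norm _ _).trans (mul_le_mul_of_nonneg_right hw₂ (norm_nonneg _))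
  have hc1 : ‖cross a w₁‖ ≤ ‖a‖ * Mw := (norm_cross_le_norm_mul_norm a w₁).trans (mul_le_mul_of_nonneg_left hw₁ (norm_nonneg _))
  have hcΔ : ‖cross a (w₁ - w₂)‖ ≤ ‖a‖ * ‖w₁ - w₂‖ := norm_cross_le_norm_mul_norm a _
  have hcv : ‖cross a v‖ ≤ ‖a‖ * ‖v‖ := norm_cross_le_norm_mul_norm a v
  have hT1 : ‖(-3 * ⟪w₁ - w₂, v⟫_ℝ * k₅₁) • cross a w₁‖ ≤ 3 * (‖w₁ - w₂‖ * ‖v‖) * m ^ (-(5 / 2 : ℝ)) * (‖a‖ * Mw) := by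
    rw [norm_smul, Real.norm_eq_abs, abs_mul, abs_mul, abs_neg, abs_of_pos (by norm_num : (0:ℝ) < 3), abs_of_nonneg hk₅₁0]
    exact mul_le_mul (mul_le_mul (mul_le_mul_of_nonneg_left hi1 (by norm_num)) hk₅₁le hk₅₁0 (by positivity)) hc1 (norm_nonneg _)
      (by positivity)
  have hT2 : ‖(-3 * ⟪w₂, v⟫_ℝ * (k₅₁ - k₅₂)) • cross a w₁‖ ≤
      3 * (Mw * ‖v‖) * ((5 / 2 : ℝ) * m ^ (-(7 / 2 : ℝ)) * (2 * Mw) * ‖w₁ - w₂‖) * (‖a‖ * Mw) := by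
    rw [norm_smul, Real.norm_eq_abs, abs_mul, abs_mul, abs_neg, abs_of_pos (by norm_num : (0:ℝ) < 3)]
    exact mul_le_mul (mul_le_mul (mul_le_mul_of_nonneg_left hi2 (by norm_num)) hd5 (abs_nonneg _) (by positivity)) hc1 (norm_nonneg _)
      (by positivity)
  have hT3 : ‖(-3 * ⟪w₂, v⟫_ℝ * k₅₂) • cross a (w₁ - w₂)‖ ≤ 3 * (Mw * ‖v‖) * m ^ (-(5 / 2 : ℝ)) * (‖a‖ * ‖w₁ - w₂‖) := by
    rw [norm_smul, Real.norm_eq_abs, abs_mul, abs_mul, abs_neg, abs_of_pos (by norm_num : (0:ℝ) < 3), abs_of_nonneg hk₅₂0]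
    exact mul_le_mul (mul_le_mul (mul_le_mul_of_nonneg_left hi2 (by norm_num)) hk₅₂le hk₅₂0 (by positivity)) hcΔ (norm_nonneg _)
      (by positivity)
  have hT4 : ‖(k₃₁ - k₃₂) • cross a v‖ ≤ ((3 / 2 : ℝ) * m ^ (-(5 / 2 : ℝ)) * (2 * Mw) * ‖w₁ - w₂‖) * (‖a‖ * ‖v‖) := by
    rw [norm_smul, Real.norm_eq_abs]
    exact mul_le_mul hd3 hcv (norm_nonneg _) (by positivity)
  calc _ ≤ ‖(-3 * ⟪w₁ - w₂, v⟫_ℝ * k₅₁) • cross a w₁ + (-3 * ⟪w₂, v⟫_ℝ * (k₅₁ - k₅₂)) • cross a w₁ +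
        (-3 * ⟪w₂, v⟫_ℝ * k₅₂) • cross a (w₁ - w₂)‖ + ‖(k₃₁ - k₃₂) • cross a v‖ := norm_add_le _ _
    _ ≤ (‖(-3 * ⟪w₁ - w₂, v⟫_ℝ * k₅₁) • cross a w₁ + (-3 * ⟪w₂, v⟫_ℝ * (k₅₁ - k₅₂)) • cross a w₁‖ +
        ‖(-3 * ⟪w₂, v⟫_ℝ * k₅₂) • cross a (w₁ - w₂)‖) + ‖(k₃₁ - k₃₂) • cross a v‖ := by gcongr; exact norm_add_le _ _
    _ ≤ ((‖(-3 * ⟪w₁ - w₂, v⟫_ℝ * k₅₁) • cross a w₁‖ + ‖(-3 * ⟪w₂, v⟫_ℝ * (k₅₁ - k₅₂)) • cross a w₁‖) +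
        ‖(-3 * ⟪w₂, v⟫_ℝ * k₅₂) • cross a (w₁ - w₂)‖) + ‖(k₃₁ - k₃₂) • cross a v‖ := by gcongr; exact norm_add_le _ _
    _ ≤ ((3 * (‖w₁ - w₂‖ * ‖v‖) * m ^ (-(5 / 2 : ℝ)) * (‖a‖ * Mw) +
          3 * (Mw * ‖v‖) * ((5 / 2 : ℝ) * m ^ (-(7 / 2 : ℝ)) * (2 * Mw) * ‖w₁ - w₂‖) * (‖a‖ * Mw)) +
          3 * (Mw * ‖v‖) * m ^ (-(5 / 2 : ℝ)) * (‖a‖ * ‖w₁ - w₂‖)) +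
          ((3 / 2 : ℝ) * m ^ (-(5 / 2 : ℝ)) * (2 * Mw) * ‖w₁ - w₂‖) * (‖a‖ * ‖v‖) :=
        add_le_add (add_le_add (add_le_add hT1 hT2) hT3) hT4
    _ = ‖a‖ * ‖v‖ * ‖w₁ - w₂‖ * (9 * Mw * m ^ (-(5 / 2 : ℝ)) + 15 * Mw ^ 3 * m ^ (-(7 / 2 : ℝ))) := by ring

end Summit.NavierStokesRegularity.NavierStokesRegularity.Theorems.SkeletonJ1RFrame

end
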